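import Summits.QuantumFields.YangMills.Theorems.LuscherReductionTwistedTraceScalingBOGaugeAvgRiderLaplace
import HarnessLib

/-!
# (C1c'-ζ) ★★★ THE LOCALISED AVERAGE OF THE BO FUNCTION OF RECORD AT A SLICE TUBE POINT: two-sided by `fpZ·e^{−q(x*)}·N(U*)` up to explicit small factors and Gaussian tails
# (lane A of S-BASE, crux `TwistedTraceScaling` stmt-QuantumFields-20203, C4-CORE, the (OD) pen; assembly of steps (1)–(3) of the (C1c') plan, `pub/ym-fleet/ym-luscher-20007-p1/COARSE-DESIGN.md` §28.4)

Composition of `…BOLocalisedAvgFP.localisedAvg_coreWeight` ((1): `A = Z·∫𝟙_core f(·⁻¹U*)`), `…BOGaugeAvgRider.boFun_frozenProfile_eq_recordChi_mul_rider` (`f = χ·R`),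
`…BOGaugeAvgRiderLaplace.gaugeAvg_rider_sandwich` ((2)+(3): `gaugeAvg (χ·R)(U*)` vs `N(U*)`) and `rider_exp_core_bounds` (the stiff rider on the chart core), for the profile of record
`Ω = frozenProfile L q_f r_f β` with `q_f β = stiffGaussExp L t b`, the weight `χ = recordChi L s K M β` and the Faddeev–Popov weight `W = coreWeight ε R₁'` (colour FP constant `Z`):
★★★ `localisedAvg_slice_bounds`:  `Z·(χ_lo·e^{−ε_q}·e^{−q(x*)}·(N(U*) − T) − ∫𝟙_{coreᶜ}(g) f(U*^{g⁻¹})dg) ≤ A(U*) ≤ Z·(C_χ·e^{ε_q}·e^{−q(x*)}·N(U*) + C_χ·T)`, the lower half given the three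
INDICATOR facts on the chart core (tube membership, `χ₀∘slowMean ≥ χ_lo`, `‖relLinkVec‖ ≤ r_f β` along the based orbit of `U*` for `‖w‖ ≤ r`; take `χ_lo = 0` to switch it off);
here `x* = linkEmbed p.1`, `N = gaugeAvg recordChi`, `T = (2π²)^{−n}e^{−c²r²/(4s²)}I(1/4)`, `ε_q = (96t+b)D(2‖x*‖+D)`, `D = ‖basedLin p‖r + Mr²`, all hypotheses of `fpWeight_laplace_bounds` in force.
What is left for (C1c') (COARSE-DESIGN §28.4): (3') `N(U*) ∈ N̄(1±Cδ²)` — ✓ in the tree (`…FPWeightRelative/CoreAt`); (4') transfer from slice tube points to the chart points `P(w)` of the (C1d)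
ball (orbit invariance of `gaugeAvg` + slice representative + `q(x(V_s))` vs `q(chartVec w)` with the gauge-mode cancellation `stiffGaussExp_add_of_ker`, `…BOCentralRelLink`); (5) the
core-complement tail; the indicator facts; rates.
HONEST FRAMING: assembly for a stub of a child of the CONDITIONAL route R2b1; (C1c') (3')(4')(5), (C4), (C5), (B-ST) OPEN; C4-CORE OPEN; not infinite volume, not a gap, not Clay.
-/

set_option autoImplicit false

noncomputable section

open MeasureTheory Real
open scoped BigOperators RealInnerProductSpace
open Literature.MathematicalPhysics.QuantumFieldTheory
open Literature.MathematicalPhysics.QuantumLattice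

namespace Summit.QuantumFields.YangMills.Theorems.FemtoTransferGap.TwoLattice.ConstTube

open Summit.QuantumFields.YangMills.Theorems.FemtoTransferGap
open Summit.QuantumFields.YangMills.Theorems.FemtoTransferGap.TwoLattice.Avg
open Summit.QuantumFields.YangMills.Theorems.FemtoTransferGap.TwoLattice.Stiff (LinkSpace stiffHessian)
open Summit.QuantumFields.YangMills.Theorems.FemtoTransferGap.TwoLattice.GnChart
open Literature.MathematicalPhysics.QuantumFieldTheory.Balaban1983to89.T4CubeChartGnomonic (gnoPoint)

variable {L : ℕ} [NeZero L]

/-! ## §1 The stiff rider as a BO function -/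

/-- The stiff rider profile `x ↦ e^{−q(x)}·𝟙{‖x‖ ≤ r}` is colour blind (`q` colour blind). [folklore] -/
theorem stiffRider_adL {q : LinkSpace L → ℝ} (hq : ∀ (g : SU2) (x : LinkSpace L), q (adL L g x) = q x) (r : ℝ) (g : SU2) (x : LinkSpace L) :
    Real.exp (-q (adL L g x)) * (Metric.closedBall (0 : LinkSpace L) r).indicator (fun _ => (1 : ℝ)) (adL L g x) =
      Real.exp (-q x) * (Metric.closedBall (0 : LinkSpace L) r).indicator (fun _ => (1 : ℝ)) x := by
  rw [hq]
  have hmem : adL L g x ∈ Metric.closedBall (0 : LinkSpace L) r ↔ x ∈ Metric.closedBall (0 : LinkSpace L) r := by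
    simp only [Metric.mem_closedBall, dist_zero_right, LinearIsometryEquiv.norm_map]
  by_cases hx : x ∈ Metric.closedBall (0 : LinkSpace L) r
  · rw [Set.indicator_of_mem hx, Set.indicator_of_mem (hmem.2 hx)]
  · rw [Set.indicator_of_notMem hx, Set.indicator_of_notMem (fun h => hx (hmem.1 h))]

/-- The stiff rider profile is measurable and takes values in `[0,1]` for `q ≥ 0`. [folklore] -/
theorem stiffRider_props {q : LinkSpace L → ℝ} (hqm : Measurable q) (hq0 : ∀ x, 0 ≤ q x) (r : ℝ) :
    Measurable (fun x : LinkSpace L => Real.exp (-q x) * (Metric.closedBall (0 : LinkSpace L) r).indicator (fun _ => (1 : ℝ)) x) ∧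
      ∀ x : LinkSpace L, 0 ≤ Real.exp (-q x) * (Metric.closedBall (0 : LinkSpace L) r).indicator (fun _ => (1 : ℝ)) x ∧
        |Real.exp (-q x) * (Metric.closedBall (0 : LinkSpace L) r).indicator (fun _ => (1 : ℝ)) x| ≤ 1 := by
  refine ⟨(Real.measurable_exp.comp hqm.neg).mul (measurable_const.indicator Metric.isClosed_closedBall.measurableSet), fun x => ?_⟩
  have hind : 0 ≤ (Metric.closedBall (0 : LinkSpace L) r).indicator (fun _ => (1 : ℝ)) x ∧ (Metric.closedBall (0 : LinkSpace L) r).indicator (fun _ => (1 : ℝ)) x ≤ 1 := by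
    by_cases hx : x ∈ Metric.closedBall (0 : LinkSpace L) r
    · rw [Set.indicator_of_mem hx]; exact ⟨zero_le_one, le_rfl⟩
    · rw [Set.indicator_of_notMem hx]; exact ⟨le_rfl, zero_le_one⟩
  have h0 : 0 ≤ Real.exp (-q x) * (Metric.closedBall (0 : LinkSpace L) r).indicator (fun _ => (1 : ℝ)) x := mul_nonneg (Real.exp_pos _).le hind.1
  refine ⟨h0, ?_⟩
  rw [abs_of_nonneg h0]
  calc _ ≤ 1 * 1 := mul_le_mul (Real.exp_le_one_iff.2 (neg_nonpos.2 (hq0 x))) hind.2 hind.1 zero_le_one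
    _ = 1 := one_mul 1

/-! ## §2 ★★★ The localised average at a slice tube point -/

/-- ★★★ **THE LOCALISED AVERAGE OF THE BO FUNCTION OF RECORD AT A SLICE TUBE POINT, TWO-SIDED.**  Hypotheses: those of `…BOGaugeAvgRiderLaplace.gaugeAvg_rider_sandwich` for the record scales
`δ = K·β^{-s}`, `ρ`, `δg = β^{-1}` (gauge width `powScale 1`), the profile `Ω = frozenProfile L q_f r_f β` with `q_f β = stiffGaussExp L t b` (`t,b ≥ 0`) and `q_f` colour blind, a class-function
amplitude `0 ≤ χ₀ ≤ C_χ`, the support inclusion `supp (boFun χ₀ Ω) ⊆ supp recordChi`, and the weight `coreWeight ε R₁'` with colour FP constant `Z ≥ 0`.  Then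
`Z·(χ_lo·e^{−ε_q}e^{−q(x*)}(N(U*) − T) − ∫𝟙_{coreᶜ} f) ≤ A(U*) ≤ Z·(C_χ·e^{ε_q}·e^{−q(x*)}·N(U*) + C_χ·T)`; the indicator facts `hind` are used by the lower half only. [cite: Luscher1983, §3] -/
theorem localisedAvg_slice_bounds (hL : Nonempty (NzSite L)) {s K M : ℝ} {β : ℝ} (hs : 0 < powScale 1 β)
    (p : balancedSubmodule L × (Fin 3 → Fin 3 → ℝ))
    {εT Mt : ℝ} (hM0 : 0 ≤ Mt) (hεT : 0 < εT)
    (hT : ∀ (ξ : basedSubmodule L) (q : balancedSubmodule L × (Fin 3 → Fin 3 → ℝ)), ‖ξ‖ < εT → ‖q‖ < εT →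
      ‖basedFn L (ξ, q) - basedFn L (0, q) - basedLin L q ξ‖ ≤ Mt * ‖ξ‖ ^ 2)
    {εC : ℝ} (hC : ∀ q : balancedSubmodule L × (Fin 3 → Fin 3 → ℝ), ‖q‖ < εC →
      ∀ ξ : basedSubmodule L, ‖ξ‖ ≤ 4 * sliceConst L * ‖(gaugeModes L).starProjection (basedLin L q ξ)‖)
    (hpT : ‖p‖ < εT) (hpC : ‖p‖ < εC) (hp40 : ‖p‖ ≤ 1 / 40)
    (hslice : (gaugeModes L).starProjection (linkEmbed L (p.1 : Edge 3 L → Fin 3 → ℝ)) = 0)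
    {ρ₁ : ℝ} (hU : tubePt L p ∈ fatTubeRho L (fun b' => K * powScale s b') (fun _ => ρ₁) β)
    {r R₁ : ℝ} (hr0 : 0 ≤ r) (hrR : r ≤ R₁) (hR1 : R₁ ≤ 1 / 2) (hR1T : R₁ < εT) (hcore : ρ₁ + 8 * r ≤ M * (K * powScale s β))
    (hsupp : 3 * ((L : ℝ) - 1) * (ρ₁ + M * (K * powScale s β)) ≤ R₁)
    (hθ : (Mt + 2 * ‖basedLin L p‖) * R₁ * (4 * sliceConst L) ≤ 1 / 4)
    -- the profile, the amplitude, the weight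
    {t b : ℝ} (ht : 0 ≤ t) (hb : 0 ≤ b) {qf : ℝ → LinkSpace L → ℝ} (hqfm : ∀ β', Measurable (qf β')) (hqf0 : ∀ β' x, 0 ≤ qf β' x)
    (hqfinv : ∀ β' (g : SU2) (x : LinkSpace L), qf β' (adL L g x) = qf β' x) (hqf : qf β = stiffGaussExp L t b) (rf : ℝ → ℝ)
    {χ₀ : GaugeConfig 3 1 SU2 → ℝ} (hχm : Measurable χ₀) {Cχ : ℝ} (hχ0 : ∀ u, 0 ≤ χ₀ u) (hCχ : ∀ u, χ₀ u ≤ Cχ)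
    (hχinv : ∀ (c : SU2) (u : GaugeConfig 3 1 SU2), χ₀ (gaugeTransform (fun _ : Site 3 1 => c) u) = χ₀ u)
    (hbo : ∀ U, boFun L χ₀ (frozenProfile L qf rf β) U ≠ 0 → recordChi L s K M β U ≠ 0)
    (ε R₁' : ℝ) {Z : ℝ} (hZ0 : 0 ≤ Z) (hZ : ∀ g : Site 3 L → SU2, ∫ c, fpWeight L ε (fun x => c * g x) ∂haarProbability SU2 = Z)
    -- indicator facts on the chart core (used by the lower bound only)
    {χlo : ℝ} (hχlo : 0 ≤ χlo)
    (hind : ∀ w : NzSite L → Fin 3 → ℝ, ‖w‖ ≤ r → gaugeTransform (basedExt L fun y => gnoPoint (w y)) (tubePt L p) ∈ orthoTubeSet L ∧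
      χlo ≤ χ₀ (slowMean L (gaugeTransform (basedExt L fun y => gnoPoint (w y)) (tubePt L p))) ∧
      ‖relLinkVec L (gaugeTransform (basedExt L fun y => gnoPoint (w y)) (tubePt L p))‖ ≤ rf β) :
    let n := Fintype.card (NzSite L)
    let sg := powScale 1 β
    let c := 1 / (4 * sliceConst L)
    let T := ((2 * π ^ 2)⁻¹) ^ n * (Real.exp (-(c ^ 2 * r ^ 2 / (4 * sg ^ 2))) * ∫ w, Real.exp (-(1 / 4 * ‖laplaceMap L p w‖ ^ 2 / sg ^ 2)))
    let D := ‖basedLin L p‖ * r + Mt * r ^ 2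
    let εq := (96 * t + b) * D * (2 * ‖linkEmbed L (p.1 : Edge 3 L → Fin 3 → ℝ)‖ + D)
    Z * (χlo * Real.exp (-εq) * Real.exp (-stiffGaussExp L t b (linkEmbed L (p.1 : Edge 3 L → Fin 3 → ℝ))) * (gaugeAvg (recordChi L s K M β) (tubePt L p) - T) -
        ∫ g, (coreSet L R₁')ᶜ.indicator (fun g => boFun L χ₀ (frozenProfile L qf rf β) (gaugeTransform g⁻¹ (tubePt L p))) g ∂gaugeMeasure L) ≤
      ∫ g, coreWeight L ε R₁' g * boFun L χ₀ (frozenProfile L qf rf β) (gaugeTransform g⁻¹ (tubePt L p)) ∂gaugeMeasure L ∧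
    ∫ g, coreWeight L ε R₁' g * boFun L χ₀ (frozenProfile L qf rf β) (gaugeTransform g⁻¹ (tubePt L p)) ∂gaugeMeasure L ≤
      Z * (Cχ * Real.exp εq * Real.exp (-stiffGaussExp L t b (linkEmbed L (p.1 : Edge 3 L → Fin 3 → ℝ))) * gaugeAvg (recordChi L s K M β) (tubePt L p) + Cχ * T) := by
  intro n sg c T D εq
  have hCχ0 : 0 ≤ Cχ := (hχ0 1).trans (hCχ 1)
  -- the BO function and its rider
  set Ω := frozenProfile L qf rf β with hΩ
  set Rprof : LinkSpace L → ℝ := fun x => Real.exp (-(qf β x)) * (Metric.closedBall (0 : LinkSpace L) (rf β)).indicator (fun _ => (1 : ℝ)) x with hRprof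
  set Rf := boFun L χ₀ Rprof with hRf
  obtain ⟨hRpm, hRp⟩ := stiffRider_props (L := L) (q := qf β) (hqfm β) (hqf0 β) (rf β)
  -- properties of `f = boFun χ₀ Ω`
  have hΩm : Measurable Ω := measurable_frozenProfile hqfm rf β
  have hfm : Measurable (boFun L χ₀ Ω) := measurable_boFun L hχm hΩm
  have hχabs : ∀ u, |χ₀ u| ≤ Cχ := fun u => by rw [abs_of_nonneg (hχ0 u)]; exact hCχ u
  have hfb : ∀ U, |boFun L χ₀ Ω U| ≤ Cχ * 1 := fun U => abs_boFun_le L hχabs (abs_frozenProfile_le hqf0 rf β) U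
  have hf0 : ∀ U, 0 ≤ boFun L χ₀ Ω U := fun U => by
    unfold boFun; exact mul_nonneg (Set.indicator_nonneg (fun _ _ => zero_le_one) _) (mul_nonneg (hχ0 _) (frozenProfile_mem_Icc hqf0 rf β _).1)
  have hfinv : ∀ (c' : SU2) (U : GaugeConfig 3 L SU2), boFun L χ₀ Ω (gaugeTransform (fun _ : Site 3 L => c') U) = boFun L χ₀ Ω U :=
    boFun_conj hχinv (fun c' x => frozenProfile_adL hqfinv rf β c' x)
  -- properties of the rider
  have hRm : Measurable Rf := measurable_boFun L hχm hRpm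
  have hR0 : ∀ U, 0 ≤ Rf U := fun U => by
    rw [hRf]; unfold boFun; exact mul_nonneg (Set.indicator_nonneg (fun _ _ => zero_le_one) _) (mul_nonneg (hχ0 _) (hRp _).1)
  have hRmax : ∀ U, Rf U ≤ Cχ := fun U => by
    have h := abs_boFun_le L hχabs (fun x => (hRp x).2) U
    rw [mul_one] at h; exact (le_abs_self _).trans h
  have hRinv : ∀ (c' : SU2) (U : GaugeConfig 3 L SU2), Rf (gaugeTransform (fun _ : Site 3 L => c') U) = Rf U :=
    boFun_conj hχinv (fun c' x => stiffRider_adL (hqfinv β) (rf β) c' x)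
  -- `f = recordChi · Rf`
  have hfac : (fun U => recordWeightRho L (fun b' => K * powScale s b') (fun b' => M * (K * powScale s b')) (powScale 1) β U * Rf U) = boFun L χ₀ Ω := by
    funext U
    show recordChi L s K M β U * Rf U = boFun L χ₀ Ω U
    rw [hΩ, boFun_frozenProfile_eq_recordChi_mul_rider s K M β qf rf χ₀ hbo U, hRf]
    rfl
  -- core bounds of the rider
  set x' : LinkSpace L := linkEmbed L (p.1 : Edge 3 L → Fin 3 → ℝ) with hx'
  have hRcore : ∀ w : NzSite L → Fin 3 → ℝ, ‖w‖ ≤ r →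
      χlo * Real.exp (-εq) * Real.exp (-stiffGaussExp L t b x') ≤ Rf (gaugeTransform (basedExt L fun y => gnoPoint (w y)) (tubePt L p)) ∧
        Rf (gaugeTransform (basedExt L fun y => gnoPoint (w y)) (tubePt L p)) ≤ Cχ * Real.exp εq * Real.exp (-stiffGaussExp L t b x') := by
    intro w hw
    set Uw := gaugeTransform (basedExt L fun y => gnoPoint (w y)) (tubePt L p) with hUw
    obtain ⟨_, hlo, hhi⟩ := rider_exp_core_bounds (L := L) ht hb p hM0 hT hpT hp40 (lt_of_le_of_lt hrR hR1T) hw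
    rw [← hUw, ← hx'] at hlo hhi
    obtain ⟨htube, hχw, hball⟩ := hind w hw
    rw [← hUw] at htube hχw hball
    have hval : Rf Uw = χ₀ (slowMean L Uw) * Real.exp (-stiffGaussExp L t b (relLinkVec L Uw)) := by
      rw [hRf]; unfold boFun
      rw [Set.indicator_of_mem htube, one_mul, hRprof]; dsimp only
      rw [Set.indicator_of_mem (by rwa [Metric.mem_closedBall, dist_zero_right]), mul_one, hqf]
    rw [hval]
    constructor
    · calc χlo * Real.exp (-εq) * Real.exp (-stiffGaussExp L t b x') = χlo * (Real.exp (-stiffGaussExp L t b x') * Real.exp (-εq)) := by ring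
        _ ≤ χ₀ (slowMean L Uw) * Real.exp (-stiffGaussExp L t b (relLinkVec L Uw)) := mul_le_mul hχw hlo (by positivity) (hχ0 _)
    · calc χ₀ (slowMean L Uw) * Real.exp (-stiffGaussExp L t b (relLinkVec L Uw)) ≤ Cχ * (Real.exp (-stiffGaussExp L t b x') * Real.exp εq) :=
            mul_le_mul (hCχ _) hhi (Real.exp_pos _).le hCχ0
        _ = Cχ * Real.exp εq * Real.exp (-stiffGaussExp L t b x') := by ring
  have hrlo0 : 0 ≤ χlo * Real.exp (-εq) * Real.exp (-stiffGaussExp L t b x') := by positivity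
  have hrhi0 : 0 ≤ Cχ * Real.exp εq * Real.exp (-stiffGaussExp L t b x') := by positivity
  -- (2)+(3): the rider sandwich at the slice tube point
  have hsand := gaugeAvg_rider_sandwich L hL (δ := fun b' => K * powScale s b') (ρ := fun b' => M * (K * powScale s b')) (δg := powScale 1) hs p hM0 hεT hT hC hpT hpC hp40 hslice hU
    hr0 hrR hR1 hR1T hcore hsupp hθ hRm hR0 hRmax hRinv hrlo0 hrhi0 hRcore
  dsimp only at hsand
  rw [hfac] at hsand
  obtain ⟨hlo', hhi'⟩ := hsand
  -- (1): the colour FP identity and the core sandwich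
  obtain ⟨_, hAup, hAlo⟩ := localisedAvg_coreWeight (L := L) ε R₁' hZ0 hZ hfm hfb hf0 hfinv (tubePt L p)
  constructor
  · refine le_trans (mul_le_mul_of_nonneg_left (sub_le_sub_right hlo' _) hZ0) (le_of_eq ?_)
    exact hAlo
  · exact le_trans hAup (mul_le_mul_of_nonneg_left hhi' hZ0)

end Summit.QuantumFields.YangMills.Theorems.FemtoTransferGap.TwoLattice.ConstTube

end
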